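import Mathlib
import HarnessLib
import Summits.Ventures.LatticeQCDFlow.Scoring.GeometricEnvelopeBlockSumMoments
import Summits.Ventures.LatticeQCDFlow.Scoring.ReversibleKernelTauIntFloor

/-!
# The VARIATIONAL (Dirichlet-form) principle for the Green–Kubo variance of a reversible kernel:
# `σ²_f = max_g {4⟨f̄, g⟩_π − 2⟨g, g − kop κ g⟩_π} − ‖f̄‖²_π`, hence the slow-mode transfer bound
# `σ²_f ≥ 2⟨f̄, g⟩² / ⟨g, g − kop κ g⟩ − ‖f̄‖²` for every bounded trial function `g`

HONEST FRAMING: exact (Metropolis-corrected) sampling algorithms for lattice gauge theory;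
figures of merit are autocorrelation/cost numbers at stated couplings and volumes; no
continuum-physics claim.

Venture `LatticeQCDFlow` (cell pub-lqcd), topic `Scoring`; FANOUT row 8 (`s0-cpn-nemc`, GEN-23).
NEW WORK of the cell, not a published result; no definition is introduced; nothing is cited as a
fact.  Setting: a Markov kernel `κ` with an invariant probability law `π` and the geometric sup-norm
envelope `|(kop κ)^[t] g − πg| ≤ 2 C_g A ρ^t` (`0 ≤ ρ < 1`; every kernel with a Doeblin power), a
bounded measurable observable `f` (`|f| ≤ C`, `f̄ = f − πf`), its Green–Kubo variance
`σ²_f = ∫ f̄² dπ + 2 Σ' k, ∫ f̄ (kop κ)^[k+1] f̄ dπ`, and ANY bounded measurable Poisson solution `h`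
(`h − kop κ h = f̄`; one exists, `Scoring/GeometricEnvelopeBlockSumMoments`).  Three elementary facts,
all on bounded observables with Bochner integrals (no spectral theory, no `L²` spaces):
(1) `σ²_f = 2⟨f̄, h⟩_π − ‖f̄‖²_π` (the martingale form `σ²_f = ∫ (kop κ (h²) − (kop κ h)²) dπ` of
`Scoring/GeometricEnvelopeBlockSumMoments` plus invariance and `kop κ h = h − f̄`);
(2) the DIRICHLET FORM `𝓔(g) := ⟨g, g − kop κ g⟩_π` equals HALF THE MEAN SQUARED JUMP,
`𝓔(g) = ½ ∫ kop κ ((g − g x)²) x dπ(x) = ½ E_π[(g(X₁) − g(X₀))²]` (invariance only), so `𝓔(g) ≥ 0`;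
(3) for a `π`-REVERSIBLE kernel the form `⟨u, v − kop κ v⟩_π` is symmetric
(`Scoring/ReversibleKernelTauIntFloor.integral_kop_mul_comm_of_isReversible`), whence
`2𝓔(h) − (4⟨f̄, g⟩ − 2𝓔(g)) = 2𝓔(h − g) ≥ 0` with `⟨f̄, g⟩ = ⟨h − kop κ h, g⟩ = ⟨h, g − kop κ g⟩`.
Together: **`σ²_f ≥ 4⟨f̄, g⟩_π − 2𝓔(g) − ‖f̄‖²_π` for EVERY bounded measurable trial function `g`, with
equality at `g = h`** — the Rayleigh–Ritz principle for `⟨f̄, (I − K)⁻¹ f̄⟩`, typed.  Optimising the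
scale of `g`: **`σ²_f ≥ 2⟨f̄, g⟩² / 𝓔(g) − ‖f̄‖²`** (`𝓔(g) > 0`): an observable that OVERLAPS a slowly
relaxing mode inherits its slowness (`τ_int,f = σ²_f/(2‖f̄‖²) ≥ cos²θ · ‖g‖²/𝓔(g) − ½`,
`cos θ = ⟨f̄, g⟩/(‖f̄‖ ‖g‖)`); with `g = f̄` this is the tree's `τ_int ≥ (1+ρ₁)/(2(1−ρ₁))` floor
(`Scoring/ReversibleKernelTauIntFloor.tauInt_ge_of_isReversible`), now for ARBITRARY trial modes.
By (2) a trial mode whose single-step jumps are at most `A_g` has `𝓔(g) ≤ A_g²/2`; the resulting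
bounded-jump floors (`σ²_f ≥ 4⟨f̄, g⟩²/A_g² − ‖f̄‖²`, and `τ_int,f ≥ 2 Var_π f/A_f² − ½` at `g = f`)
are the companion file `Scoring/ReversibleVarianceJumpFloor`.  Printed counterparts NAMED ONLY: the Rayleigh–Ritz / Dirichlet-form characterisation of the asymptotic
variance of reversible chains and the bounded-jump corollary (Caracciolo–Pelissetto–Sokal 1990;
Madras–Slade, *The Self-Avoiding Walk*, Prop. 9.2.2 and Cor. 9.2.3, eq. (9.2.28); Sokal's 1989/1996
lecture notes) — nothing is cited as a fact.

## Content (`π` invariant probability law; envelope `(A, ρ)`, `0 ≤ ρ < 1`, where `σ²_f` appears;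
## `|f| ≤ C`, `|g| ≤ C_g`, `|h| ≤ C_h` measurable; `h − kop κ h = f − πf`)

* **`greenKubo_eq_two_inner_poisson_sub_of_envelope`** — `σ²_f = 2 ∫ f̄ h dπ − ∫ f̄² dπ`;
* **`kopDirichlet_eq_half_meanSqJump`** — `∫ g (g − kop κ g) dπ = ½ ∫ (∫ (g y − g x)² dκ(x,·)) dπ(x)`;
  `kopDirichlet_nonneg` — `0 ≤ ∫ g (g − kop κ g) dπ`;
* `inner_poisson_eq_kopDirichletCross_of_isReversible` — `∫ f̄ g dπ = ∫ h (g − kop κ g) dπ` (reversible);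
  `kopDirichlet_sub_eq_of_isReversible` — `𝓔(h − g) = 𝓔(h) − 2 ∫ h (g − kop κ g) dπ + 𝓔(g)`;
* **`greenKubo_ge_variational_of_isReversible`** — `σ²_f ≥ 4 ∫ f̄ g dπ − 2 𝓔(g) − ∫ f̄² dπ`, every `g`;
  **`greenKubo_eq_variational_at_poisson`** — equality at `g = h`;
* **`greenKubo_ge_overlap_sq_div_dirichlet_of_isReversible`** — `𝓔(g) > 0 ⇒ σ²_f ≥ 2 (∫ f̄ g dπ)²/𝓔(g) − ∫ f̄² dπ`.

NOT CLAIMED: non-reversible kernels (only (1), (2) hold); unbounded observables / `L²` trial functions;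
the supremum over `g` as an `sSup` (stated as "every `g`" + "equality at `h`"); the bounded-jump
floors (companion file); any number of ours.
-/

noncomputable section

namespace Summit.Ventures.LatticeQCDFlow.Scoring

open MeasureTheory ProbabilityTheory Filter Finset Preorder Literature.Probability.MarkovChains
open scoped ENNReal Topology

variable {Ω : Type*} [MeasurableSpace Ω]

/-- The product of two bounded measurable observables is integrable against a finite measure. -/
private theorem integrable_mul_bdd (μ : Measure Ω) [IsFiniteMeasure μ] {u w : Ω → ℝ}
    (hu : Measurable u) (hw : Measurable w) {Cu Cw : ℝ} (hCu : ∀ x, |u x| ≤ Cu)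
    (hCw : ∀ x, |w x| ≤ Cw) : Integrable (fun x => u x * w x) μ := by
  refine integrable_of_bounded μ (hu.mul hw) (C := |Cu| * Cw) fun x => ?_
  rw [abs_mul]
  exact mul_le_mul ((hCu x).trans (le_abs_self _)) (hCw x) (abs_nonneg _) (abs_nonneg _)

/-! ### (1) `σ²_f = 2⟨f̄, h⟩ − ‖f̄‖²` for any bounded Poisson solution -/

section Envelope

variable {κ : Kernel Ω Ω} [IsMarkovKernel κ] {π : Measure Ω} [IsProbabilityMeasure π] {A ρ : ℝ}

/-- **`σ²_f = 2 ∫ f̄ h dπ − ∫ f̄² dπ`** for every bounded measurable `h` with `h − kop κ h = f̄`, under the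
envelope with `π` invariant (`0 ≤ ρ < 1`). -/
theorem greenKubo_eq_two_inner_poisson_sub_of_envelope (hπ : Kernel.Invariant κ π)
    (henv : ∀ (g : Ω → ℝ), Measurable g → ∀ (Cg : ℝ), (∀ x, |g x| ≤ Cg) →
      ∀ (t : ℕ) (x : Ω), |(kop κ)^[t] g x - ∫ y, g y ∂π| ≤ 2 * Cg * (A * ρ ^ t))
    (hρ0 : 0 ≤ ρ) (hρ1 : ρ < 1)
    {f : Ω → ℝ} (hf : Measurable f) {C : ℝ} (hC : ∀ x, |f x| ≤ C)
    {h : Ω → ℝ} (hh : Measurable h) {Ch : ℝ} (hCh : ∀ x, |h x| ≤ Ch)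
    (hpois : ∀ y, h y - kop κ h y = f y - ∫ z, f z ∂π) :
    (∫ y, (f y - ∫ z, f z ∂π) ^ 2 ∂π)
        + 2 * ∑' k, ∫ y, (f y - ∫ z, f z ∂π) * (kop κ)^[k + 1] (fun y => f y - ∫ z, f z ∂π) y ∂π
      = 2 * ∫ y, (f y - ∫ z, f z ∂π) * h y ∂π - ∫ y, (f y - ∫ z, f z ∂π) ^ 2 ∂π := by
  rw [← poisson_condVar_integral_eq_greenKubo_of_envelope hπ henv hρ0 hρ1 hf hC hh hCh hpois]
  obtain ⟨hfb, hCfb, -⟩ := centred_observable_bounds π hf hC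
  have hh2 : Measurable fun y => h y ^ 2 := hh.pow_const 2
  have hCh2 : ∀ y, |h y ^ 2| ≤ Ch ^ 2 := fun y => by
    rw [abs_pow]; exact pow_le_pow_left₀ (abs_nonneg _) (hCh y) 2
  have hi1 : Integrable (fun y => kop κ (fun z => h z ^ 2) y) π :=
    integrable_of_bounded π (measurable_kop κ hh2) (abs_kop_le κ hCh2)
  have hi2 : Integrable (fun y => (kop κ h y) ^ 2) π :=
    integrable_of_bounded π ((measurable_kop κ hh).pow_const 2) (C := Ch ^ 2) fun y => by
      rw [abs_pow]; exact pow_le_pow_left₀ (abs_nonneg _) (abs_kop_le κ hCh y) 2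
  rw [integral_sub hi1 hi2, integral_kop κ hπ hh2 hCh2]
  -- `kop κ h = h − f̄`
  have hK : ∀ y, kop κ h y = h y - (f y - ∫ z, f z ∂π) := fun y => by linarith [hpois y]
  have e : (fun y => (kop κ h y) ^ 2)
      = fun y => (h y ^ 2 - 2 * ((f y - ∫ z, f z ∂π) * h y)) + (f y - ∫ z, f z ∂π) ^ 2 := by
    funext y; rw [hK y]; ring
  have hi3 : Integrable (fun y => h y ^ 2) π := integrable_of_bounded π hh2 hCh2
  have hi4 : Integrable (fun y => (f y - ∫ z, f z ∂π) * h y) π := integrable_mul_bdd π hfb hh hCfb hCh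
  have hi5 : Integrable (fun y => (f y - ∫ z, f z ∂π) ^ 2) π :=
    integrable_of_bounded π (hfb.pow_const 2) (C := (2 * C) ^ 2) fun y => by
      rw [abs_pow]; exact pow_le_pow_left₀ (abs_nonneg _) (hCfb y) 2
  have hi34 : Integrable (fun y => h y ^ 2 - 2 * ((f y - ∫ z, f z ∂π) * h y)) π :=
    hi3.sub (hi4.const_mul 2)
  have hi4' : Integrable (fun y => 2 * ((f y - ∫ z, f z ∂π) * h y)) π := hi4.const_mul 2
  rw [e, integral_add hi34 hi5, integral_sub hi3 hi4', integral_const_mul]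
  ring

end Envelope

/-! ### (2) The Dirichlet form is half the mean squared jump (invariance only) -/

section Dirichlet

variable (κ : Kernel Ω Ω) [IsMarkovKernel κ] {π : Measure Ω} [IsProbabilityMeasure π]

/-- **`∫ g (g − kop κ g) dπ = ½ ∫ kop κ (fun y ↦ (g y − g x)²) x dπ(x)`** for `π` invariant and `g`
bounded measurable: the Dirichlet form is half the stationary mean squared one-step jump of `g`. -/
theorem kopDirichlet_eq_half_meanSqJump (hπ : Kernel.Invariant κ π) {g : Ω → ℝ} (hg : Measurable g)
    {Cg : ℝ} (hCg : ∀ x, |g x| ≤ Cg) :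
    ∫ x, g x * (g x - kop κ g x) ∂π
      = (1 / 2) * ∫ x, (∫ y, (g y - g x) ^ 2 ∂(κ x)) ∂π := by
  have hCg0 : 0 ≤ Cg := (abs_nonneg _).trans (hCg (Classical.choice (nonempty_of_isProbabilityMeasure π)))
  have hg2 : Measurable fun y => g y ^ 2 := hg.pow_const 2
  have hCg2 : ∀ y, |g y ^ 2| ≤ Cg ^ 2 := fun y => by
    rw [abs_pow]; exact pow_le_pow_left₀ (abs_nonneg _) (hCg y) 2
  -- the inner integral: `∫ (g y − g x)² dκx = K(g²) x − 2 g x · K g x + g x²`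
  have hinner : ∀ x, ∫ y, (g y - g x) ^ 2 ∂(κ x)
      = kop κ (fun y => g y ^ 2) x - 2 * g x * kop κ g x + g x ^ 2 := by
    intro x
    have e : (fun y => (g y - g x) ^ 2) = fun y => (g y ^ 2 - (2 * g x) * g y) + g x ^ 2 := by
      funext y; ring
    have hi1 : Integrable (fun y => g y ^ 2) (κ x) := integrable_of_bounded _ hg2 hCg2
    have hi2 : Integrable (fun y => (2 * g x) * g y) (κ x) :=
      (integrable_of_bounded _ hg hCg).const_mul _
    have hi12 : Integrable (fun y => g y ^ 2 - (2 * g x) * g y) (κ x) := hi1.sub hi2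
    rw [e, integral_add hi12 (integrable_const _), integral_sub hi1 hi2, integral_const_mul,
      integral_const, probReal_univ, one_smul]
    unfold kop
    ring
  have hK2i : Integrable (fun x => kop κ (fun y => g y ^ 2) x) π :=
    integrable_of_bounded π (measurable_kop κ hg2) (abs_kop_le κ hCg2)
  have hgKg : Integrable (fun x => g x * kop κ g x) π :=
    integrable_mul_bdd π hg (measurable_kop κ hg) hCg (abs_kop_le κ hCg)
  have hg2i : Integrable (fun x => g x ^ 2) π := integrable_of_bounded π hg2 hCg2
  have hrhs : ∫ x, (∫ y, (g y - g x) ^ 2 ∂(κ x)) ∂π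
      = 2 * ∫ x, g x ^ 2 ∂π - 2 * ∫ x, g x * kop κ g x ∂π := by
    have e : (fun x => ∫ y, (g y - g x) ^ 2 ∂(κ x))
        = fun x => (kop κ (fun y => g y ^ 2) x - 2 * (g x * kop κ g x)) + g x ^ 2 := by
      funext x; rw [hinner x]; ring
    have hiA : Integrable (fun x => kop κ (fun y => g y ^ 2) x - 2 * (g x * kop κ g x)) π :=
      hK2i.sub (hgKg.const_mul 2)
    have hiB : Integrable (fun x => 2 * (g x * kop κ g x)) π := hgKg.const_mul 2
    rw [e, integral_add hiA hg2i, integral_sub hK2i hiB, integral_const_mul,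
      integral_kop κ hπ hg2 hCg2]
    ring
  have hlhs : ∫ x, g x * (g x - kop κ g x) ∂π = ∫ x, g x ^ 2 ∂π - ∫ x, g x * kop κ g x ∂π := by
    have e : (fun x => g x * (g x - kop κ g x)) = fun x => g x ^ 2 - g x * kop κ g x := by
      funext x; ring
    rw [e, integral_sub hg2i hgKg]
  rw [hlhs, hrhs]
  ring

/-- **`0 ≤ ∫ g (g − kop κ g) dπ`** for `π` invariant (the Dirichlet form is nonnegative). -/
theorem kopDirichlet_nonneg (hπ : Kernel.Invariant κ π) {g : Ω → ℝ} (hg : Measurable g)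
    {Cg : ℝ} (hCg : ∀ x, |g x| ≤ Cg) : 0 ≤ ∫ x, g x * (g x - kop κ g x) ∂π := by
  rw [kopDirichlet_eq_half_meanSqJump κ hπ hg hCg]
  exact mul_nonneg (by norm_num) (integral_nonneg fun x => integral_nonneg fun y => sq_nonneg _)

end Dirichlet

/-! ### (3) Reversible kernels: the variational principle -/

section Reversible

variable {κ : Kernel Ω Ω} [IsMarkovKernel κ] {π : Measure Ω} [IsProbabilityMeasure π] {A ρ : ℝ}

/-- **`∫ f̄ g dπ = ∫ h (g − kop κ g) dπ`** for a `π`-reversible kernel, `h − kop κ h = f̄` and `g`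
bounded measurable: the overlap with `f̄` is the Dirichlet CROSS form with the Poisson solution. -/
theorem inner_poisson_eq_kopDirichletCross_of_isReversible (hrev : Kernel.IsReversible κ π)
    {f : Ω → ℝ} {h : Ω → ℝ} (hh : Measurable h) {Ch : ℝ} (hCh : ∀ x, |h x| ≤ Ch)
    (hpois : ∀ y, h y - kop κ h y = f y - ∫ z, f z ∂π)
    {g : Ω → ℝ} (hg : Measurable g) {Cg : ℝ} (hCg : ∀ x, |g x| ≤ Cg) :
    ∫ y, (f y - ∫ z, f z ∂π) * g y ∂π = ∫ y, h y * (g y - kop κ g y) ∂π := by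
  have e1 : (fun y => (f y - ∫ z, f z ∂π) * g y) = fun y => h y * g y - kop κ h y * g y := by
    funext y; rw [← hpois y]; ring
  have e2 : (fun y => h y * (g y - kop κ g y)) = fun y => h y * g y - h y * kop κ g y := by
    funext y; ring
  have hi1 : Integrable (fun y => h y * g y) π := integrable_mul_bdd π hh hg hCh hCg
  have hi2 : Integrable (fun y => kop κ h y * g y) π :=
    integrable_mul_bdd π (measurable_kop κ hh) hg (abs_kop_le κ hCh) hCg
  have hi3 : Integrable (fun y => h y * kop κ g y) π :=
    integrable_mul_bdd π hh (measurable_kop κ hg) hCh (abs_kop_le κ hCg)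
  rw [e1, e2, integral_sub hi1 hi2, integral_sub hi1 hi3,
    integral_kop_mul_comm_of_isReversible κ hrev hh hg hCh hCg]

/-- **`𝓔(h − g) = 𝓔(h) − 2 ∫ h (g − kop κ g) dπ + 𝓔(g)`** for a `π`-reversible kernel and bounded
measurable `h, g` (`𝓔(u) = ∫ u (u − kop κ u) dπ`). -/
theorem kopDirichlet_sub_eq_of_isReversible (hrev : Kernel.IsReversible κ π)
    {h : Ω → ℝ} (hh : Measurable h) {Ch : ℝ} (hCh : ∀ x, |h x| ≤ Ch)
    {g : Ω → ℝ} (hg : Measurable g) {Cg : ℝ} (hCg : ∀ x, |g x| ≤ Cg) :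
    ∫ y, (h y - g y) * ((h y - g y) - kop κ (fun z => h z - g z) y) ∂π
      = ∫ y, h y * (h y - kop κ h y) ∂π - 2 * ∫ y, h y * (g y - kop κ g y) ∂π
        + ∫ y, g y * (g y - kop κ g y) ∂π := by
  -- linearity of `kop`: `K(h − g) = K h − K g`
  have hlin : ∀ y, kop κ (fun z => h z - g z) y = kop κ h y - kop κ g y := fun y => by
    have e := kop_add_mul κ hh hg hCh hCg (-1) y
    have e' : (fun s => h s + (-1) * g s) = fun z => h z - g z := by funext s; ring
    rw [e'] at e
    rw [e]; ring
  -- symmetry: `∫ g · K h = ∫ h · K g` i.e. `∫ (K h) g = ∫ h (K g)`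
  have hsymm : ∫ y, g y * kop κ h y ∂π = ∫ y, h y * kop κ g y ∂π := by
    have e := integral_kop_mul_comm_of_isReversible κ hrev hh hg hCh hCg
    have e1 : ∫ y, g y * kop κ h y ∂π = ∫ y, kop κ h y * g y ∂π :=
      integral_congr_ae (ae_of_all _ fun y => by ring)
    rw [e1, e]
  have hi_hh : Integrable (fun y => h y * h y) π := integrable_mul_bdd π hh hh hCh hCh
  have hi_gg : Integrable (fun y => g y * g y) π := integrable_mul_bdd π hg hg hCg hCg
  have hi_hg : Integrable (fun y => h y * g y) π := integrable_mul_bdd π hh hg hCh hCg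
  have hi_hKh : Integrable (fun y => h y * kop κ h y) π :=
    integrable_mul_bdd π hh (measurable_kop κ hh) hCh (abs_kop_le κ hCh)
  have hi_hKg : Integrable (fun y => h y * kop κ g y) π :=
    integrable_mul_bdd π hh (measurable_kop κ hg) hCh (abs_kop_le κ hCg)
  have hi_gKh : Integrable (fun y => g y * kop κ h y) π :=
    integrable_mul_bdd π hg (measurable_kop κ hh) hCg (abs_kop_le κ hCh)
  have hi_gKg : Integrable (fun y => g y * kop κ g y) π :=
    integrable_mul_bdd π hg (measurable_kop κ hg) hCg (abs_kop_le κ hCg)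
  -- write every integrand as a combination of the six basic products
  have eL : (fun y => (h y - g y) * ((h y - g y) - kop κ (fun z => h z - g z) y))
      = fun y => ((h y * h y - h y * kop κ h y) - 2 * (h y * g y) + (h y * kop κ g y + g y * kop κ h y))
          + (g y * g y - g y * kop κ g y) := by
    funext y; rw [hlin y]; ring
  have e1 : (fun y => h y * (h y - kop κ h y)) = fun y => h y * h y - h y * kop κ h y := by
    funext y; ring
  have e2 : (fun y => h y * (g y - kop κ g y)) = fun y => h y * g y - h y * kop κ g y := by
    funext y; ring
  have e3 : (fun y => g y * (g y - kop κ g y)) = fun y => g y * g y - g y * kop κ g y := by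
    funext y; ring
  have hiA : Integrable (fun y => h y * h y - h y * kop κ h y) π := hi_hh.sub hi_hKh
  have hiB : Integrable (fun y => 2 * (h y * g y)) π := hi_hg.const_mul 2
  have hiC : Integrable (fun y => h y * kop κ g y + g y * kop κ h y) π := hi_hKg.add hi_gKh
  have hiD : Integrable (fun y => g y * g y - g y * kop κ g y) π := hi_gg.sub hi_gKg
  have hiAB : Integrable (fun y => (h y * h y - h y * kop κ h y) - 2 * (h y * g y)) π := hiA.sub hiB
  have hiABC : Integrable (fun y => (h y * h y - h y * kop κ h y) - 2 * (h y * g y)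
      + (h y * kop κ g y + g y * kop κ h y)) π := hiAB.add hiC
  rw [eL, e1, e2, e3, integral_add hiABC hiD, integral_add hiAB hiC, integral_sub hiA hiB,
    integral_add hi_hKg hi_gKh, integral_const_mul, integral_sub hi_hg hi_hKg, hsymm]
  ring

/-- **THE VARIATIONAL LOWER BOUND.**  `κ` `π`-reversible with the envelope (`0 ≤ ρ < 1`), `|f| ≤ C`
measurable; for EVERY bounded measurable trial function `g`:
`σ²_f ≥ 4 ∫ f̄ g dπ − 2 ∫ g (g − kop κ g) dπ − ∫ f̄² dπ`. -/
theorem greenKubo_ge_variational_of_isReversible (hrev : Kernel.IsReversible κ π)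
    (henv : ∀ (g : Ω → ℝ), Measurable g → ∀ (Cg : ℝ), (∀ x, |g x| ≤ Cg) →
      ∀ (t : ℕ) (x : Ω), |(kop κ)^[t] g x - ∫ y, g y ∂π| ≤ 2 * Cg * (A * ρ ^ t))
    (hρ0 : 0 ≤ ρ) (hρ1 : ρ < 1)
    {f : Ω → ℝ} (hf : Measurable f) {C : ℝ} (hC : ∀ x, |f x| ≤ C)
    {g : Ω → ℝ} (hg : Measurable g) {Cg : ℝ} (hCg : ∀ x, |g x| ≤ Cg) :
    4 * ∫ y, (f y - ∫ z, f z ∂π) * g y ∂π - 2 * ∫ y, g y * (g y - kop κ g y) ∂π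
        - ∫ y, (f y - ∫ z, f z ∂π) ^ 2 ∂π
      ≤ (∫ y, (f y - ∫ z, f z ∂π) ^ 2 ∂π)
        + 2 * ∑' k, ∫ y, (f y - ∫ z, f z ∂π) * (kop κ)^[k + 1] (fun y => f y - ∫ z, f z ∂π) y ∂π := by
  have hπ : Kernel.Invariant κ π := hrev.invariant
  obtain ⟨h, hh, hCh, hpois⟩ := poisson_exists_of_geometricEnvelope henv hρ0 hρ1 hf hC
  rw [greenKubo_eq_two_inner_poisson_sub_of_envelope hπ henv hρ0 hρ1 hf hC hh hCh hpois,
    inner_poisson_eq_kopDirichletCross_of_isReversible hrev hh hCh hpois hh hCh,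
    inner_poisson_eq_kopDirichletCross_of_isReversible hrev hh hCh hpois hg hCg]
  -- `2𝓔(h) − 4B(h,g) + 2𝓔(g) = 2𝓔(h − g) ≥ 0`
  have hsub := kopDirichlet_sub_eq_of_isReversible hrev hh hCh hg hCg
  have hnn : 0 ≤ ∫ y, (h y - g y) * ((h y - g y) - kop κ (fun z => h z - g z) y) ∂π :=
    kopDirichlet_nonneg κ hπ (hh.sub hg) (Cg := 4 * C * A / (1 - ρ) + Cg) fun x =>
      (abs_sub _ _).trans (add_le_add (hCh x) (hCg x))
  rw [hsub] at hnn
  linarith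

/-- **Equality in the variational bound at the Poisson solution**: with `g = h`,
`4 ∫ f̄ h dπ − 2 ∫ h (h − kop κ h) dπ − ∫ f̄² dπ = σ²_f` (envelope, `π` invariant; no reversibility
needed since `∫ f̄ h dπ = ∫ h (h − kop κ h) dπ` pointwise from `h − kop κ h = f̄`). -/
theorem greenKubo_eq_variational_at_poisson (hπ : Kernel.Invariant κ π)
    (henv : ∀ (g : Ω → ℝ), Measurable g → ∀ (Cg : ℝ), (∀ x, |g x| ≤ Cg) →
      ∀ (t : ℕ) (x : Ω), |(kop κ)^[t] g x - ∫ y, g y ∂π| ≤ 2 * Cg * (A * ρ ^ t))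
    (hρ0 : 0 ≤ ρ) (hρ1 : ρ < 1)
    {f : Ω → ℝ} (hf : Measurable f) {C : ℝ} (hC : ∀ x, |f x| ≤ C)
    {h : Ω → ℝ} (hh : Measurable h) {Ch : ℝ} (hCh : ∀ x, |h x| ≤ Ch)
    (hpois : ∀ y, h y - kop κ h y = f y - ∫ z, f z ∂π) :
    4 * ∫ y, (f y - ∫ z, f z ∂π) * h y ∂π - 2 * ∫ y, h y * (h y - kop κ h y) ∂π
        - ∫ y, (f y - ∫ z, f z ∂π) ^ 2 ∂π
      = (∫ y, (f y - ∫ z, f z ∂π) ^ 2 ∂π)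
        + 2 * ∑' k, ∫ y, (f y - ∫ z, f z ∂π) * (kop κ)^[k + 1] (fun y => f y - ∫ z, f z ∂π) y ∂π := by
  rw [greenKubo_eq_two_inner_poisson_sub_of_envelope hπ henv hρ0 hρ1 hf hC hh hCh hpois]
  have e : ∫ y, h y * (h y - kop κ h y) ∂π = ∫ y, (f y - ∫ z, f z ∂π) * h y ∂π :=
    integral_congr_ae (ae_of_all _ fun y => by
      show h y * (h y - kop κ h y) = (f y - ∫ z, f z ∂π) * h y
      rw [hpois y]; ring)
  rw [e]
  ring

/-- **THE SLOW-MODE TRANSFER BOUND.**  `κ` `π`-reversible with the envelope, `|f| ≤ C` measurable; for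
every bounded measurable `g` with `𝓔(g) = ∫ g (g − kop κ g) dπ > 0`:
`σ²_f ≥ 2 (∫ f̄ g dπ)² / 𝓔(g) − ∫ f̄² dπ` (the variational bound at the optimal multiple of `g`). -/
theorem greenKubo_ge_overlap_sq_div_dirichlet_of_isReversible (hrev : Kernel.IsReversible κ π)
    (henv : ∀ (g : Ω → ℝ), Measurable g → ∀ (Cg : ℝ), (∀ x, |g x| ≤ Cg) →
      ∀ (t : ℕ) (x : Ω), |(kop κ)^[t] g x - ∫ y, g y ∂π| ≤ 2 * Cg * (A * ρ ^ t))
    (hρ0 : 0 ≤ ρ) (hρ1 : ρ < 1)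
    {f : Ω → ℝ} (hf : Measurable f) {C : ℝ} (hC : ∀ x, |f x| ≤ C)
    {g : Ω → ℝ} (hg : Measurable g) {Cg : ℝ} (hCg : ∀ x, |g x| ≤ Cg)
    (hE : 0 < ∫ y, g y * (g y - kop κ g y) ∂π) :
    2 * (∫ y, (f y - ∫ z, f z ∂π) * g y ∂π) ^ 2 / ∫ y, g y * (g y - kop κ g y) ∂π
        - ∫ y, (f y - ∫ z, f z ∂π) ^ 2 ∂π
      ≤ (∫ y, (f y - ∫ z, f z ∂π) ^ 2 ∂π)
        + 2 * ∑' k, ∫ y, (f y - ∫ z, f z ∂π) * (kop κ)^[k + 1] (fun y => f y - ∫ z, f z ∂π) y ∂π := by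
  set a := ∫ y, (f y - ∫ z, f z ∂π) * g y ∂π with ha
  set E := ∫ y, g y * (g y - kop κ g y) ∂π with hEdef
  set c := a / E with hc
  -- apply the variational bound to the trial function `c · g`
  have hcg : Measurable fun y => c * g y := hg.const_mul c
  have hCcg : ∀ x, |c * g x| ≤ |c| * Cg := fun x => by
    rw [abs_mul]; exact mul_le_mul_of_nonneg_left (hCg x) (abs_nonneg _)
  have hvar := greenKubo_ge_variational_of_isReversible hrev henv hρ0 hρ1 hf hC hcg hCcg
  -- `∫ f̄ (c g) = c a`, `𝓔(c g) = c² E`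
  have hKc : ∀ y, kop κ (fun z => c * g z) y = c * kop κ g y := fun y => by
    unfold kop; exact integral_const_mul c _
  have e1 : ∫ y, (f y - ∫ z, f z ∂π) * (c * g y) ∂π = c * a := by
    rw [ha, ← integral_const_mul]
    exact integral_congr_ae (ae_of_all _ fun y => by ring)
  have e2 : ∫ y, (c * g y) * ((c * g y) - kop κ (fun z => c * g z) y) ∂π = c ^ 2 * E := by
    rw [hEdef, ← integral_const_mul]
    exact integral_congr_ae (ae_of_all _ fun y => by
      simp only [hKc y]; ring)
  rw [e1, e2] at hvar
  have hval : 4 * (c * a) - 2 * (c ^ 2 * E) = 2 * a ^ 2 / E := by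
    rw [hc]; field_simp; ring
  linarith

end Reversible

end Summit.Ventures.LatticeQCDFlow.Scoring

end
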